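import Summits.CriticalPhenomena.CardyFormulaZ2.Theorems.CardyIKTransportIKLinearTransportScreening
import Summits.CriticalPhenomena.CardyFormulaZ2.Theorems.CardyIKTransportIKLinearTransportScreeningArrayExact
import Summits.CriticalPhenomena.CardyFormulaZ2.Theorems.CardyIKTransportIKLinearTransportRatioMixEndgame

/-!
# The screening inequality in DENSITY form for synthetic statistics (`screening_master_mul`)

Theorem-only support file (`--supports stmt-CriticalPhenomena-5076`) for the line `pinned-diagram-exchange` of the
crux `CardyIKTransport.IKLinearTransport`: proves the registered sub-goal `screening_master_mul` (sub-goal 2/3 of the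
skeleton stub `stub_RatioMix`) by name and signature.

STATEMENT: for `[0, 1]`-valued, environment-measurable synthetic statistics `envE x kk` (far statistic, read
through the parities of the internal plaquette array) and `bInd x t cc` (box statistic, read through the box data
and the box coins, the environment acting by offsets), assuming the exact screening sum `Σ_exact ≤ 1` and a
MULTIPLICATIVE offset bound with factor `Tf ≥ 1` for nonnegative statistics of the box data,
`|E[envE·bInd] − E[envE] E[bInd]| ≤ (2 Σ_exact Tf + (Tf − 1)) · E[envE] · E[bInd]`.

PROOF: the density-form twin of `screening_master` (`…IKLinearTransportScreening.lean` §5.4). Integrate out the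
internal plaquettes and the box coins (`integral_env_box`, `integral_env`, `integral_box`), screen pointwise in the
environment with the PRODUCT-form array estimate `screeningArrayExact` summed over the parity fibres
(`screening_pointwise_exact` below), compare the box functional across environments by the multiplicative offset
hypothesis, and conclude with the multiplicative abstract endgame `abs_integral_sub_mul_le_mul`
(`…RatioMixEndgame.lean`) with `s = 2 Σ_exact`, `t = Tf − 1`.
-/

noncomputable section

namespace Summit.CriticalPhenomena.CardyFormulaZ2.Theorems.IKLinearTransport.PinnedDiagramExchange.ScreeningAssembly

open scoped Classical symmDiff BigOperators
open MeasureTheory ProbabilityTheory Set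
open Literature.Probability.Percolation Literature.Probability.LatticeModels
open ScreeningGauge ScreeningArray

/-- SCREENING IN PRODUCT FORM, pointwise in the environment (from the landed `screeningArrayExact`): for a
`[0, 1]`-valued UR-determined statistic `F` of the array and nonnegative parity weights `env`,
`|E[env(parities) F] − E[env(parities)] E[F]| ≤ 2 Σ_exact · E[env(parities)] · E[F]` (sum the fibrewise
product-form bounds over the parity classes). [folklore] -/
theorem screening_pointwise_exact (m k n : ℕ) (hn : 1 ≤ n) (hnm : n ≤ m) (hnk : n ≤ k) (p : Fin m → ℝ)
    (θ : ℝ) (hp : ∀ c, 0 ≤ p c ∧ p c ≤ 1) (hθ0 : 0 ≤ θ) (hθ1 : θ ≤ 1)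
    (hpθ : ∀ c, |1 - 2 * p c| ≤ θ) (hσ : sigmaExact m k n θ ≤ 1)
    (F : (Fin m × Fin k → Bool) → ℝ) (hF : ∀ q, 0 ≤ F q ∧ F q ≤ 1)
    (hFdet : ∀ q q' : Fin m × Fin k → Bool,
      (∀ f : Fin m × Fin k, n ≤ (f.1 : ℕ) → n ≤ (f.2 : ℕ) → q f = q' f) → F q = F q')
    (env : (Fin m → Bool) × (Fin k → Bool) → ℝ) (henv : ∀ kk, 0 ≤ env kk) :
    |arrSum p (fun q => env (parities q) * F q) - arrSum p (fun q => env (parities q)) * arrSum p F| ≤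
      2 * sigmaExact m k n θ * (arrSum p (fun q => env (parities q)) * arrSum p F) := by
  have h1 := arrSum_fiber p env F
  have h2 : arrSum p (fun q => env (parities q)) = ∑ kk : (Fin m → Bool) × (Fin k → Bool),
      env kk * arrSum p (fun q => if parities q = kk then 1 else 0) := by
    have h := arrSum_fiber p env (fun _ => 1)
    simp only [mul_one] at h
    exact h
  rw [h1, h2, Finset.sum_mul, Finset.mul_sum, ← Finset.sum_sub_distrib]
  refine (Finset.abs_sum_le_sum_abs _ _).trans (Finset.sum_le_sum fun kk _ => ?_)
  have hA := screeningArrayExact m k n hn hnm hnk p θ hp hθ0 hθ1 hpθ hσ F hF hFdet kk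
  have heq : env kk * arrSum p (fun q => if parities q = kk then F q else 0) -
      env kk * arrSum p (fun q => if parities q = kk then 1 else 0) * arrSum p F =
      env kk * (arrSum p (fun q => if parities q = kk then F q else 0) -
        arrSum p F * arrSum p (fun q => if parities q = kk then 1 else 0)) := by ring
  rw [heq, abs_mul, abs_of_nonneg (henv kk)]
  calc env kk * |arrSum p (fun q => if parities q = kk then F q else 0) -
        arrSum p F * arrSum p (fun q => if parities q = kk then 1 else 0)|
      ≤ env kk * (2 * sigmaExact m k n θ *
          (arrSum p F * arrSum p (fun q => if parities q = kk then 1 else 0))) :=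
        mul_le_mul_of_nonneg_left hA (henv kk)
    _ = 2 * sigmaExact m k n θ *
          (env kk * arrSum p (fun q => if parities q = kk then 1 else 0) * arrSum p F) := by ring

/-- REGISTERED SUB-GOAL `screening_master_mul` — THE SCREENING INEQUALITY IN DENSITY FORM for synthetic
statistics: for `[0, 1]`-valued, environment-measurable `envE x kk` (far statistic, read through the parities)
and `bInd x t cc` (box statistic, read through the box data and the coins, the environment acting by offsets),
under `Σ_exact ≤ 1` and the multiplicative offset bound with factor `Tf ≥ 1`,
`|E[envE·bInd] − E[envE] E[bInd]| ≤ (2 Σ_exact Tf + (Tf − 1)) E[envE] E[bInd]`. Integrate out `(Qarr, Cbox)`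
(`integral_env_box` / `integral_env` / `integral_box`), screen pointwise in the environment
(`screening_pointwise_exact`), use the multiplicative rigidity of the box functional across environments (the
offset hypothesis), and finish with `abs_integral_sub_mul_le_mul`. [folklore] -/
theorem screening_master_mul :
    ∀ (S : Set ℤ) (a b : ℤ) (w h n : ℕ), 1 ≤ n →
      sigmaExact (w + 2 * n - 1) (h + 2 * n - 1) n θIK ≤ 1 →
      ∀ (Tf : ℝ), 1 ≤ Tf →
      (∀ (G : (Fin w × Fin h → Bool) → ℝ), (∀ t, 0 ≤ G t) → ∀ (A : Fin w → Bool) (B : Fin h → Bool),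
        arrSum (k := h + 2 * n - 1) (pcol S (a - n) (w + 2 * n - 1))
            (fun q => G (fun ij => xor (boxData n w h q ij) (xor (A ij.1) (B ij.2)))) ≤
          Tf * arrSum (k := h + 2 * n - 1) (pcol S (a - n) (w + 2 * n - 1)) (fun q => G (boxData n w h q))) →
      ∀ (envE : Ω → (Fin (w + 2 * n - 1) → Bool) × (Fin (h + 2 * n - 1) → Bool) → ℝ)
        (bInd : Ω → (Fin w × Fin h → Bool) → (Fin w × Fin h → Bool) → ℝ),
      (∀ kk, Measurable fun x => envE x kk) → (∀ x kk, 0 ≤ envE x kk ∧ envE x kk ≤ 1) →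
      (∀ t cc, Measurable fun x => bInd x t cc) → (∀ x t cc, 0 ≤ bInd x t cc ∧ bInd x t cc ≤ 1) →
      (∀ x x' : Ω, ∃ (A : Fin w → Bool) (B : Fin h → Bool), ∀ t cc,
        bInd x' t cc = bInd x (fun ij => xor (t ij) (xor (A ij.1) (B ij.2))) cc) →
      |(∫ ω, envE (projEnv a b w h n ω) (parities (Qarr S (a - n) (b - n) (w + 2 * n - 1) (h + 2 * n - 1) ω)) *
            bInd (projEnv a b w h n ω) (boxData n w h (Qarr S (a - n) (b - n) (w + 2 * n - 1) (h + 2 * n - 1) ω))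
              (Cbox a b w h ω) ∂μIK) -
          (∫ ω, envE (projEnv a b w h n ω)
              (parities (Qarr S (a - n) (b - n) (w + 2 * n - 1) (h + 2 * n - 1) ω)) ∂μIK) *
            ∫ ω, bInd (projEnv a b w h n ω)
              (boxData n w h (Qarr S (a - n) (b - n) (w + 2 * n - 1) (h + 2 * n - 1) ω)) (Cbox a b w h ω) ∂μIK| ≤
        (2 * sigmaExact (w + 2 * n - 1) (h + 2 * n - 1) n θIK * Tf + (Tf - 1)) *
          ((∫ ω, envE (projEnv a b w h n ω)
              (parities (Qarr S (a - n) (b - n) (w + 2 * n - 1) (h + 2 * n - 1) ω)) ∂μIK) *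
            ∫ ω, bInd (projEnv a b w h n ω)
              (boxData n w h (Qarr S (a - n) (b - n) (w + 2 * n - 1) (h + 2 * n - 1) ω)) (Cbox a b w h ω) ∂μIK) := by
  intro S a b w h n hn hσ Tf hTf hoffMul envE bInd henvm henv hbm hb hoff
  haveI := CouplingToLimits.isProbabilityMeasure_μIK
  obtain ⟨hp, hpθ, hθ0, hθ1⟩ := pcol_props S (a - n) (w + 2 * n - 1)
  have hnm : n ≤ w + 2 * n - 1 := by omega
  have hnk : n ≤ h + 2 * n - 1 := by omega
  rw [integral_env_box S a b w h n (w + 2 * n - 1) (h + 2 * n - 1) rfl rfl hn envE bInd henvm henv hbm hb,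
    integral_env S a b w h n (w + 2 * n - 1) (h + 2 * n - 1) rfl rfl hn envE henvm henv,
    integral_box S a b w h n (w + 2 * n - 1) (h + 2 * n - 1) rfl rfl hn bInd hbm hb]
  set p := pcol S (a - n) (w + 2 * n - 1) with hpdef
  -- the coin average `Γ x t := Σ_cc 2^{-wh} bInd x t cc` and its properties
  have hΓ : ∀ x t, 0 ≤ ∑ cc, (1 / 2 : ℝ) ^ (w * h) * bInd x t cc ∧
      ∑ cc, (1 / 2 : ℝ) ^ (w * h) * bInd x t cc ≤ 1 := fun x t => coinAvg_mem w h (bInd x t) (hb x t)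
  have hΓm : ∀ t, Measurable fun x => ∑ cc, (1 / 2 : ℝ) ^ (w * h) * bInd x t cc := fun t =>
    Finset.measurable_sum _ fun cc _ => (hbm t cc).const_mul _
  -- measurability and integrability of the three integrands
  have hIm : Measurable fun x => arrSum p (fun q => envE x (parities q) *
      ∑ cc, (1 / 2 : ℝ) ^ (w * h) * bInd x (boxData n w h q) cc) := by
    unfold arrSum
    exact Finset.measurable_sum _ fun q _ => ((henvm (parities q)).mul (hΓm (boxData n w h q))).const_mul _
  have hem : Measurable fun x => arrSum p (fun q => envE x (parities q)) := by
    unfold arrSum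
    exact Finset.measurable_sum _ fun q _ => (henvm (parities q)).const_mul _
  have hgm : Measurable fun x => arrSum p (fun q : Fin (w + 2 * n - 1) × Fin (h + 2 * n - 1) → Bool =>
      ∑ cc, (1 / 2 : ℝ) ^ (w * h) * bInd x (boxData n w h q) cc) := by
    unfold arrSum
    exact Finset.measurable_sum _ fun q _ => (hΓm (boxData n w h q)).const_mul _
  have hbound : ∀ G : (Fin (w + 2 * n - 1) × Fin (h + 2 * n - 1) → Bool) → ℝ,
      (∀ q, 0 ≤ G q ∧ G q ≤ 1) → |arrSum p G| ≤ 1 := fun G hG =>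
    abs_arrSum_le_one p hp G fun q => abs_le.2 ⟨by linarith [(hG q).1], (hG q).2⟩
  have integ : ∀ F : Ω → ℝ, Measurable F → (∀ x, |F x| ≤ 1) →
      Integrable (fun ω => F (projEnv a b w h n ω)) μIK := fun F hF hF1 =>
    Integrable.of_bound ((hF.comp (measurable_projEnv a b w h n)).aestronglyMeasurable) 1
      (Filter.Eventually.of_forall fun ω => by rw [Real.norm_eq_abs]; exact hF1 _)
  have hI : Integrable (fun ω => arrSum p (fun q => envE (projEnv a b w h n ω) (parities q) *
      ∑ cc, (1 / 2 : ℝ) ^ (w * h) * bInd (projEnv a b w h n ω) (boxData n w h q) cc)) μIK :=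
    integ (fun x => arrSum p (fun q => envE x (parities q) *
      ∑ cc, (1 / 2 : ℝ) ^ (w * h) * bInd x (boxData n w h q) cc)) hIm fun x =>
        hbound (fun q => envE x (parities q) * ∑ cc, (1 / 2 : ℝ) ^ (w * h) * bInd x (boxData n w h q) cc)
          fun q => ⟨mul_nonneg (henv x _).1 (hΓ x _).1, mul_le_one₀ (henv x _).2 (hΓ x _).1 (hΓ x _).2⟩
  have he : Integrable (fun ω => arrSum p (fun q => envE (projEnv a b w h n ω) (parities q))) μIK :=
    integ (fun x => arrSum p (fun q => envE x (parities q))) hem fun x =>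
      hbound (fun q => envE x (parities q)) fun q => henv x _
  have hg : Integrable (fun ω => arrSum p (fun q : Fin (w + 2 * n - 1) × Fin (h + 2 * n - 1) → Bool =>
      ∑ cc, (1 / 2 : ℝ) ^ (w * h) * bInd (projEnv a b w h n ω) (boxData n w h q) cc)) μIK :=
    integ (fun x => arrSum p (fun q : Fin (w + 2 * n - 1) × Fin (h + 2 * n - 1) → Bool =>
      ∑ cc, (1 / 2 : ℝ) ^ (w * h) * bInd x (boxData n w h q) cc)) hgm fun x =>
        hbound (fun q : Fin (w + 2 * n - 1) × Fin (h + 2 * n - 1) → Bool =>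
          ∑ cc, (1 / 2 : ℝ) ^ (w * h) * bInd x (boxData n w h q) cc) fun q => hΓ x _
  -- the error constant in the shape `s (1 + t) + t` of the multiplicative endgame, `s = 2 Σ_exact`, `t = Tf - 1`
  have hconst : 2 * sigmaExact (w + 2 * n - 1) (h + 2 * n - 1) n θIK * Tf + (Tf - 1) =
      2 * sigmaExact (w + 2 * n - 1) (h + 2 * n - 1) n θIK * (1 + (Tf - 1)) + (Tf - 1) := by ring
  rw [hconst]
  refine abs_integral_sub_mul_le_mul μIK _ _ _ hI he hg
    (2 * sigmaExact (w + 2 * n - 1) (h + 2 * n - 1) n θIK) (Tf - 1) ?_ ?_ ?_ ?_ ?_ ?_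
  · -- `0 ≤ s`
    exact mul_nonneg (by norm_num) (sigmaExact_nonneg _ _ n hn hnm hnk θIK hθ0)
  · -- `0 ≤ t`
    exact sub_nonneg.mpr hTf
  · -- `0 ≤ e`
    intro ω
    exact Finset.sum_nonneg fun q _ => mul_nonneg (arrWeight_nonneg p hp q) (henv _ _).1
  · -- `0 ≤ g`
    intro ω
    exact Finset.sum_nonneg fun q _ => mul_nonneg (arrWeight_nonneg p hp q) (hΓ _ _).1
  · -- screening in product form, pointwise in the environment
    intro ω
    exact screening_pointwise_exact _ _ n hn hnm hnk p θIK hp hθ0 hθ1 hpθ hσ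
      (fun q => ∑ cc, (1 / 2 : ℝ) ^ (w * h) * bInd (projEnv a b w h n ω) (boxData n w h q) cc)
      (fun q => hΓ _ _)
      (fun q q' hqq' => congrArg (fun t => ∑ cc, (1 / 2 : ℝ) ^ (w * h) * bInd (projEnv a b w h n ω) t cc)
        (boxData_congr n w h q q' hqq'))
      (envE (projEnv a b w h n ω)) (fun kk => (henv _ kk).1)
  · -- multiplicative rigidity of the box functional across environments (offsets)
    intro ω ω'
    obtain ⟨A, B, hAB⟩ := hoff (projEnv a b w h n ω) (projEnv a b w h n ω')
    have hγ' : arrSum p (fun q : Fin (w + 2 * n - 1) × Fin (h + 2 * n - 1) → Bool =>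
        ∑ cc, (1 / 2 : ℝ) ^ (w * h) * bInd (projEnv a b w h n ω') (boxData n w h q) cc) =
        arrSum p (fun q : Fin (w + 2 * n - 1) × Fin (h + 2 * n - 1) → Bool =>
          ∑ cc, (1 / 2 : ℝ) ^ (w * h) * bInd (projEnv a b w h n ω)
            (fun ij => xor (boxData n w h q ij) (xor (A ij.1) (B ij.2))) cc) := by
      simp only [hAB]
    rw [hγ', show 1 + (Tf - 1) = Tf by ring]
    exact hoffMul (fun t => ∑ cc, (1 / 2 : ℝ) ^ (w * h) * bInd (projEnv a b w h n ω) t cc)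
      (fun t => (hΓ _ t).1) A B

end Summit.CriticalPhenomena.CardyFormulaZ2.Theorems.IKLinearTransport.PinnedDiagramExchange.ScreeningAssembly
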